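import Summits.Parity.BatemanHorn.Theorems.SoloInformedDivisorSumErdosBounds
import Literature.NumberTheory.Sieve.GoldstonGrahamPintzYildirimProofs

/-!
# `A_g > 0`: the Dedekind–Landau constant is positive, and Erdős's lower bound `∑τ(|g(n)|) ≫ x log x` follows

Solo informed line (Parity / Bateman–Horn), session 136.  The constant `A_g = rootLevelConst g` of
`∑_{d≤x} ρ_g(d)/d = A_g log x + O(1)` (`SoloInformedRootCountLevel`) is shown POSITIVE for every irreducible `g` of
positive degree:

* `rootDensityConst_one_pos` — the squarefree constant `c_{g,1} = c_γ` (`γ = γ_{g,1}`) is positive: `c_γ ≥ 0` as a limit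
  of positive partial products, and `c_γ ≠ 0` because GGPY Lemma 3 at `z = 2` reads `|1 − c_γ log 2| ≤ C c_γ L`
  (the Maynard-file trick, `Literature/…/Maynard2016Lemma93EmSummation.cGamma_emGamma_pos`);
* `rootDensityConst_one_le_rootLevelConst` — `c_{g,1} ≤ A_g`, since `∑_{d≤x, μ²=1} ρ_g(d)/d ≤ ∑_{d≤x} ρ_g(d)/d` and
  both are `(const)·log x + O(1)`;
* `rootLevelConst_pos` — `A_g > 0`;
* `exists_erdos_lower_bound` — hence, with `SoloInformedDivisorSumErdosBounds.eventually_le_polyDivisorSum_div`, for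
  every irreducible `g` of degree `≥ 2`: eventually `A_g · x log x ≤ ∑_{n≤x} τ(|g(n)|)` — a kernel-checked form of
  Erdős's (1952) lower bound `∑_{n≤x} d(g(n)) ≫ x log x`, with the explicit constant `A_g`.
-/

open Finset Real Polynomial Filter Topology

namespace Summit.Parity.BatemanHorn.Theorems

open Literature.NumberTheory.Sieve

/-- **`c_{g,1} > 0`** for `g` irreducible of positive degree. [this work] -/
theorem rootDensityConst_one_pos {g : ℤ[X]} (hirr : Irreducible g) (hdeg : 0 < g.natDegree) :
    0 < rootDensityConst g 1 := by
  obtain ⟨A₂, L₀, hA₂, hL₀, hΩ₂⟩ := hypOmega2_rootGamma hirr hdeg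
  set A₁ : ℝ := ((g.natDegree : ℝ) + 2) / 2 with hA₁def
  have hA₁ : 0 < A₁ := by positivity
  obtain ⟨C₀, hC₀⟩ := GGPY.moebiusSqGSum_asymptotic_holds A₁ A₂ hA₁ hA₂
  have h1 := hypOmega1_rootGamma hirr hdeg 1
  have h2 := hΩ₂ 1 one_pos
  simp only [Nat.cast_one, Real.log_one, mul_zero, add_zero] at h2
  obtain ⟨ht, hz⟩ := hC₀ L₀ hL₀ (rootGamma g 1) h1 h2
  have h0 : 0 ≤ GGPY.cGamma (rootGamma g 1) := GGPY.cGamma_nonneg hA₁ h1 ht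
  unfold rootDensityConst
  rcases h0.lt_or_eq with h | h
  · exact h
  · exfalso
    have h22 := hz 2 le_rfl
    rw [GGPY.moebiusSqGSum_two, ← h] at h22
    norm_num at h22

/-- The squarefree part of the level sum is at most the whole: `∑_{d≤x, μ²(d)=1} ρ_g(d)/d ≤ ∑_{d≤x} ρ_g(d)/d`. -/
theorem polySqfreeLevel_one_le_polySmallLevel (g : ℤ[X]) (x : ℕ) :
    polySqfreeLevel g 1 x ≤ polySmallLevel g x := by
  unfold polySqfreeLevel polySmallLevel
  exact Finset.sum_le_sum_of_subset_of_nonneg (Finset.filter_subset _ _) fun d _ _ => by positivity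

/-- **`c_{g,1} ≤ A_g`**. [this work] -/
theorem rootDensityConst_one_le_rootLevelConst {g : ℤ[X]} (hirr : Irreducible g) (hdeg : 0 < g.natDegree) :
    rootDensityConst g 1 ≤ rootLevelConst g := by
  obtain ⟨K, hK⟩ := exists_abs_polySmallLevel_sub_log_le hirr hdeg
  obtain ⟨K', hK'⟩ := exists_abs_polySqfreeLevel_sub_le hirr hdeg
  obtain ⟨_, _, _, hx1⟩ := hK' 1 one_pos
  by_contra hlt'
  have hlt := not_le.mp hlt'
  set c := rootDensityConst g 1 with hc
  set A := rootLevelConst g with hA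
  have hδ : 0 < c - A := by linarith
  set B : ℝ := (K + K' + 1) / (c - A) with hB
  obtain ⟨x, hxB, hx1'⟩ : ∃ x : ℕ, B < Real.log (x : ℝ) ∧ 1 ≤ x := by
    refine ⟨⌈Real.exp B⌉₊ + 1, ?_, by omega⟩
    have h1 : Real.exp B < ((⌈Real.exp B⌉₊ + 1 : ℕ) : ℝ) := by
      have := Nat.le_ceil (Real.exp B)
      push_cast
      linarith
    calc B = Real.log (Real.exp B) := (Real.log_exp B).symm
      _ < Real.log (((⌈Real.exp B⌉₊ + 1 : ℕ) : ℝ)) := Real.log_lt_log (Real.exp_pos B) h1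
  have e1 := hK x hx1'
  have e2 := hx1 x hx1'
  simp only [Nat.cast_one, Real.log_one, add_zero, mul_one] at e2
  have e3 := polySqfreeLevel_one_le_polySmallLevel g x
  rw [abs_le] at e1 e2
  have h3 : (c - A) * Real.log (x : ℝ) ≤ K + K' := by linarith [e1.2, e2.1]
  have h4 : K + K' + 1 < (c - A) * Real.log (x : ℝ) := by
    have := (div_lt_iff₀ hδ).mp hxB
    linarith
  linarith

/-- **`A_g > 0`** for every irreducible `g` of positive degree. [this work] -/
theorem rootLevelConst_pos {g : ℤ[X]} (hirr : Irreducible g) (hdeg : 0 < g.natDegree) :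
    0 < rootLevelConst g :=
  lt_of_lt_of_le (rootDensityConst_one_pos hirr hdeg) (rootDensityConst_one_le_rootLevelConst hirr hdeg)

/-- **Erdős's lower bound, kernel-checked with an explicit constant**: for every irreducible `g` of degree `≥ 2`,
eventually `A_g · x log x ≤ ∑_{n≤x} τ(|g(n)|)`, with `A_g > 0`. [this work] -/
theorem exists_erdos_lower_bound {g : ℤ[X]} (hirr : Irreducible g) (hdeg : 2 ≤ g.natDegree) :
    0 < rootLevelConst g ∧
      ∀ᶠ x : ℕ in atTop, rootLevelConst g * ((x : ℝ) * Real.log x) ≤ (polyDivisorSum g x : ℝ) := by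
  have hA := rootLevelConst_pos hirr (by omega)
  refine ⟨hA, ?_⟩
  have h := eventually_le_polyDivisorSum_div hirr hdeg hA
  filter_upwards [h, eventually_ge_atTop 2] with x hx hx2
  have hx' : (2 : ℝ) ≤ x := by exact_mod_cast hx2
  have hlogpos : 0 < Real.log (x : ℝ) := Real.log_pos (by linarith)
  have hden : 0 < (x : ℝ) * Real.log x := by positivity
  have h1 : 2 * rootLevelConst g - rootLevelConst g = rootLevelConst g := by ring
  rw [h1, le_div_iff₀ hden] at hx
  exact hx

/-- **Two-sided with explicit constants, conditional only on the upper side**: `A_g x log x ≤ S_g(x)` eventually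
(unconditional) — and `S_g(x) ≤ K x log x` is equivalent to the Chebyshev bound for the located root count
(`polyDivisorSum_upper_iff_located_upper`). [this work] -/
theorem erdos_order_summary {g : ℤ[X]} (hirr : Irreducible g) (hdeg : 2 ≤ g.natDegree) :
    (0 < rootLevelConst g ∧
      ∀ᶠ x : ℕ in atTop, rootLevelConst g * ((x : ℝ) * Real.log x) ≤ (polyDivisorSum g x : ℝ)) ∧
    ((∃ K : ℝ, ∀ x : ℕ, 2 ≤ x → (polyDivisorSum g x : ℝ) ≤ K * ((x : ℝ) * Real.log x)) ↔
      (∃ K : ℝ, ∀ x : ℕ, 2 ≤ x → (polyLocatedRootCount g x : ℝ) ≤ K * ((x : ℝ) * Real.log x))) :=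
  ⟨exists_erdos_lower_bound hirr hdeg, polyDivisorSum_upper_iff_located_upper hirr hdeg⟩

end Summit.Parity.BatemanHorn.Theorems
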